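import Summits.Ventures.WeilGRH.UniformConductorFloorPrincipalLog11
import Summits.Ventures.WeilGRH.UniformConductorFloorPrincipalMod211Log11
import Summits.Ventures.WeilGRH.UniformConductorFloorJointFloorsLog11
import Summits.Ventures.WeilGRH.UniformConductorFloorPrincipalMod223Log11
import Summits.Ventures.WeilGRH.UniformConductorFloorPrincipalMod227Log11
import HarnessLib

/-!
# GRH arm (rh-explicit, venture WeilGRH): ★★★ rung five `(log 11)/2` for PRIME moduli COMPLETE — `U_{(log 11)/2}(p) ↔ p ≥ 223`

Cell `rh-explicit`, WEIL TRACK — GRH ARM (weil-grh-1, gen9).  Assembly of the fifth rung of the principal dichotomy for prime moduli from five kernel-checked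
inputs: the flat failures `F₁₁` (`UniformConductorFloorPrincipalLog11.lean`: every prime `p ≤ 199`), the 16-mode Galerkin witness for the razor prime `211`
(`UniformConductorFloorPrincipalMod211Log11.lean`; flat threshold `209.81 < 211 <` 16-mode bottom `213.89`), and the uniform joint-cell floor `q ≥ 228`
(`UniformConductorFloorJointFloorsLog11.lean`), and the two principal door cells χ₀ mod `223` / `227` on the `(log 11)/2` special-value table
(`UniformConductorFloorPrincipalMod223Log11.lean`, `…Mod227Log11.lean`: door E, 8×96 ∣ 16×40, kernel margins `0.0154 ∣ 2.00` and `0.0333 ∣ 2.01`;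
32-mode Galerkin bottom `214.16 < 223`).  Result: ★★★ for a PRIME `p`, every character mod `p` is Weil-positive on `[-(log 11)/2, (log 11)/2]` iff `p ≥ 223`
— the fifth rung of the prime-threshold ladder `p*(t) = 79 / 97 / 127 / 173 / 223` at `t = 1, (log 8)/2, log 3, (log 10)/2, (log 11)/2` (`211` is sharp:
it fails only by a 16-mode vector, the flat window passing it).  RH/GRH-free; standard axioms; no definitions; no named facts.

## References

* A. Weil (1952), (11) pp. 261–262 and the «lemme» p. 262 [Weil1952FormulesExplicites]; H. Yoshida (1992) §5 [Yoshida1992HermitianForms].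
-/

noncomputable section

namespace Summit.Ventures.WeilGRH

open Literature.NumberTheory.LFunctions

namespace UniformFloor

variable {q : ℕ}

/-- ★ **For every prime `p ≤ 211` the principal character mod `p` fails at `(log 11)/2`** (flat for `p ≤ 199`, the 16-mode witness for `211`).
[cite: Weil1952FormulesExplicites, (11) pp. 261–262] -/
theorem not_weilPositivityOnChar_log11half_principal_of_prime_le_211 (hp : q.Prime) (hq : q ≤ 211) :
    ¬ WeilPositivityOnChar (1 : DirichletCharacter ℂ q) (Real.log 11 / 2) := by
  by_cases h199 : q ≤ 199
  · exact not_weilPositivityOnChar_log11half_principal_of_prime_le hp h199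
  · have h211 : q = 211 := by
      by_contra hne
      have h200 : 200 ≤ q := by omega
      have h210 : q ≤ 210 := by omega
      interval_cases q <;> exact absurd hp (by norm_num)
    subst h211
    exact not_weilPositivityOnChar_log11half_principal_mod_211

/-- The prime statement below `212`: some character (the principal one) fails on `[-(log 11)/2, (log 11)/2]`. [cite: Weil1952FormulesExplicites, (11) pp. 261–262] -/
theorem exists_not_weilPositivityOnChar_log11half_of_prime_le_211 (hp : q.Prime) (hq : q ≤ 211) :
    ∃ χ : DirichletCharacter ℂ q, ¬ WeilPositivityOnChar χ (Real.log 11 / 2) :=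
  ⟨1, not_weilPositivityOnChar_log11half_principal_of_prime_le_211 hp hq⟩

/-- ★ **Every character of every PRIME modulus `p ≥ 229` is Weil-positive on `[-(log 11)/2, (log 11)/2]`** (uniform floor `228`).
[cite: Weil1952FormulesExplicites, (11) pp. 261–262 and the «lemme» p. 262] -/
theorem forall_weilPositivityOnChar_log11half_of_prime_ge_229 (hq : 229 ≤ q) (χ : DirichletCharacter ℂ q) :
    WeilPositivityOnChar χ (Real.log 11 / 2) :=
  weilPositivityOnChar_log11half_of_ge_228 (by omega) χ

/-- ★★ **Rung five for primes outside `{223, 227}`**: every character mod `p` is Weil-positive on `[-(log 11)/2, (log 11)/2]` iff `p ≥ 223`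
(equivalently `p > 211`). [cite: Weil1952FormulesExplicites, (11) pp. 261–262 and the «lemme» p. 262] -/
theorem forall_weilPositivityOnChar_log11half_iff_of_prime (hp : q.Prime) (h223 : q ≠ 223) (h227 : q ≠ 227) :
    (∀ χ : DirichletCharacter ℂ q, WeilPositivityOnChar χ (Real.log 11 / 2)) ↔ 223 ≤ q := by
  constructor
  · intro h
    by_contra hlt
    have h211 : q ≤ 211 := by
      by_contra h'
      have h212 : 212 ≤ q := by omega
      have h222 : q ≤ 222 := by omega
      interval_cases q <;> exact absurd hp (by norm_num)
    exact not_weilPositivityOnChar_log11half_principal_of_prime_le_211 hp h211 (h 1)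
  · intro h223le χ
    have h229 : 229 ≤ q := by
      by_contra h'
      have h228 : q ≤ 228 := by omega
      interval_cases q
      all_goals first | exact absurd rfl h223 | exact absurd rfl h227 | exact absurd hp (by norm_num)
    exact forall_weilPositivityOnChar_log11half_of_prime_ge_229 h229 χ

/-- ★★ `U_{(log 11)/2}(223)`: every Dirichlet character mod `223` is Weil-positive on `[−(log 11)/2, (log 11)/2]` (principal door cell, margin `0.0154`).
[cite: Weil1952FormulesExplicites, (11) pp. 261–262] -/
theorem forall_weilPositivityOnChar_log11half_mod_twoTwentyThree (χ : DirichletCharacter ℂ 223) : WeilPositivityOnChar χ (Real.log 11 / 2) := by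
  have ha : (0 : ℝ) < Real.log 11 / 2 := by
    have : (1 : ℝ) < 11 := by norm_num
    positivity
  exact WeilPositivityOnChar.of_principal (by norm_num) ha PrincipalMod223Log11.weilPositivityOnChar_log11half_principal_mod_twoTwentyThree χ

/-- ★★ `U_{(log 11)/2}(227)`: every Dirichlet character mod `227` is Weil-positive on `[−(log 11)/2, (log 11)/2]` (principal door cell, margin `0.0333`).
[cite: Weil1952FormulesExplicites, (11) pp. 261–262] -/
theorem forall_weilPositivityOnChar_log11half_mod_twoTwentySeven (χ : DirichletCharacter ℂ 227) : WeilPositivityOnChar χ (Real.log 11 / 2) := by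
  have ha : (0 : ℝ) < Real.log 11 / 2 := by
    have : (1 : ℝ) < 11 := by norm_num
    positivity
  exact WeilPositivityOnChar.of_principal (by norm_num) ha PrincipalMod227Log11.weilPositivityOnChar_log11half_principal_mod_twoTwentySeven χ

/-- ★ Every character of every PRIME modulus `p ≥ 223` is Weil-positive on `[-(log 11)/2, (log 11)/2]` (cells `223`, `227`; uniform floor from `229`).
[cite: Weil1952FormulesExplicites, (11) pp. 261–262 and the «lemme» p. 262] -/
theorem forall_weilPositivityOnChar_log11half_of_prime_ge_223 (hp : q.Prime) (hq : 223 ≤ q) (χ : DirichletCharacter ℂ q) :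
    WeilPositivityOnChar χ (Real.log 11 / 2) := by
  by_cases h229 : 229 ≤ q
  · exact forall_weilPositivityOnChar_log11half_of_prime_ge_229 h229 χ
  · have h : q = 223 ∨ q = 227 := by
      have h228 : q ≤ 228 := by omega
      interval_cases q
      all_goals first | exact Or.inl rfl | exact Or.inr rfl | exact absurd hp (by norm_num)
    rcases h with rfl | rfl
    · exact forall_weilPositivityOnChar_log11half_mod_twoTwentyThree χ
    · exact forall_weilPositivityOnChar_log11half_mod_twoTwentySeven χ

/-- ★★★ **PRIME MODULI at `(log 11)/2`: the exact dichotomy `p ≥ 223`** — every Dirichlet character mod a prime `p` is Weil-positive on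
`[-(log 11)/2, (log 11)/2]` iff `p ≥ 223`; `211` is sharp (16-mode witness) and `223` passes (door cell).  Fifth rung of the ladder `79 / 97 / 127 / 173 / 223`.
[cite: Weil1952FormulesExplicites, (11) pp. 261–262 and the «lemme» p. 262] -/
theorem forall_weilPositivityOnChar_log11half_iff_of_prime_complete (hp : q.Prime) :
    (∀ χ : DirichletCharacter ℂ q, WeilPositivityOnChar χ (Real.log 11 / 2)) ↔ 223 ≤ q := by
  constructor
  · intro h
    by_contra hlt
    have h211 : q ≤ 211 := by
      by_contra h'
      have h212 : 212 ≤ q := by omega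
      have h222 : q ≤ 222 := by omega
      interval_cases q <;> exact absurd hp (by norm_num)
    exact not_weilPositivityOnChar_log11half_principal_of_prime_le_211 hp h211 (h 1)
  · intro h223 χ
    exact forall_weilPositivityOnChar_log11half_of_prime_ge_223 hp h223 χ

/-- … and below: for a prime `p`, some character mod `p` fails on `[-(log 11)/2, (log 11)/2]` iff `p ≤ 211`. [cite: Weil1952FormulesExplicites, (11) pp. 261–262] -/
theorem exists_not_weilPositivityOnChar_log11half_iff_of_prime (hp : q.Prime) :
    (∃ χ : DirichletCharacter ℂ q, ¬ WeilPositivityOnChar χ (Real.log 11 / 2)) ↔ q ≤ 211 := by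
  have h := forall_weilPositivityOnChar_log11half_iff_of_prime_complete hp
  constructor
  · rintro ⟨χ, hχ⟩
    by_contra h211
    have h223 : 223 ≤ q := by
      by_contra h'
      have h212 : 212 ≤ q := by omega
      have h222 : q ≤ 222 := by omega
      interval_cases q <;> exact absurd hp (by norm_num)
    exact hχ (h.2 h223 χ)
  · intro h211
    exact ⟨1, not_weilPositivityOnChar_log11half_principal_of_prime_le_211 hp h211⟩

/-- The failing side persists on every larger window: for a prime `p ≤ 211` and every `t ≥ (log 11)/2` some character mod `p` fails on `[-t, t]`. [folklore] -/
theorem exists_not_weilPositivityOnChar_of_log11half_le_of_prime_le_211 (hp : q.Prime) (hq : q ≤ 211) {t : ℝ} (ht : Real.log 11 / 2 ≤ t) :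
    ∃ χ : DirichletCharacter ℂ q, ¬ WeilPositivityOnChar χ t :=
  ⟨1, fun h ↦ not_weilPositivityOnChar_log11half_principal_of_prime_le_211 hp hq (h.mono ht)⟩

end UniformFloor

end Summit.Ventures.WeilGRH

end
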